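import Summits.QuantumFields.YangMills.Theorems.UnitScaleTiltFlatPortAllSizesAllL
import HarnessLib

/-!
# Route `UnitScaleTilt`, crux K1 child «MinimiserStabilityRegPr» (stmt-QuantumFields-19200), registered stub `stub_halvingStep` (H) —
# **THE P2 TEXT OF RECORD `FlatCubeOpsText.FlatOpsAdmAtMS L …` IS INHABITED FOR EVERY ODD `L ≥ 3`** (file `FlatOpsAdmAtMSAllL`)

The H-door of record ✓`HalvingStepOfPillars.halvingStep_of_rows (hP2) (hP1) (hCE)` (and `hP2_pos_of_nonneg`, ✓`HalvingAssembly.H_of_package`,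
✓`HalvingQuarterCubeSeq.quarter164_of_flatOpsAdmAtMS`, ✓`ChartHInvFromFlatOps.chartRemainderAt_of_flatOpsAdmAtMS`) read the P2 pillar text
`FlatCubeOpsText.FlatOpsAdmAtMS L R₀ M₀ B₀ δ₀ B₃` — «for every family `F` with block size `F.L = L`, every `n < K`, every `R ≥ R₀`, every `M ≥ M₀` that is
a power of `L`, every nested domain datum `D` of depth `K − n` that is `(R, M)`-admissible ((2.1)–(2.2) of [Balaban1984PropagatorsII]) and every level
weight `w`, the canonical `H = GQ*(QGQ*)⁻¹`, `G̃ = G − HQG` with the (157)∕(158)∕(165) sup letters at constant `B₀` and a distance `dBI ≥ distBI` carrying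
the (162) row sum `B₃` and the (157) decay letter at rate `δ₀`» — as a HYPOTHESIS; its only producers so far (✓`FlatOpsLettersAssembly.flatOpsAdmAtMS_of_rows`,
✓`FlatOpsFromKernelRows.flatOpsAdmAtMS_of_kernelRows`) are conditional assemblers.  After the (α) covering chain (α1–α7) and the `hℓ : 4 ≤ ℓ` deletion
(α8, ✓`FlatPortAllSizesAllL.body_of_adm22_allSizes_allL`) the BODY of the text holds at every admissible datum of the concrete family `⟨ℓ+1, hL, m, hm⟩`
for every odd `L = ℓ + 1 ≥ 3` and every torus size.  THIS FILE is the last, purely logical knit: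

* ★★ **`flatOpsAdmAtMS_allL (L) (hL : Odd L ∧ 1 < L) : ∃ R₀ M₀ B₀ δ₀ B₃, 0 < B₀ ∧ 0 < δ₀ ∧ 0 < B₃ ∧ FlatOpsAdmAtMS L R₀ M₀ B₀ δ₀ B₃`** — the P2 text
  inhabited (= the v8 registered-era stub text `stub_flatOpsCubeSeq` of `FlatCubeOpsText` §4, for every ODD `L > 1`);
* ★ **`hP2_holds`** — the `hP2` binder of ✓`halvingStep_of_rows` VERBATIM (`∀ L, Odd L → 1 < L → ∃ …, 0 < B₀ ∧ 0 < δ₀ ∧ 0 < B₃ ∧ FlatOpsAdmAtMS L …`), so the door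
  reads `halvingStep_of_rows hP2_holds hP1 hCE`; **`hP2₀_holds`** — the weak-sign form (`0 ≤ B₀`) that `hP2_pos_of_nonneg` consumes.

PROOF (bookkeeping only, no estimate is proved here): a generic `F : T3Family` with `F.L = ℓ + 1` IS `⟨ℓ+1, F.hL, F.m, F.hm⟩` (structure eta; `F.P K` and α8's
`PV 2 ℓ m K _ hL` agree by proof irrelevance); the text's size binder `M = L^a ≥ M₀` is met by choosing `M₀ := L·max Mh₀ 1`, which forces `a = a′ + 1`,
`M = L·L^{a′}` and `Mh := L^{a′} ≥ Mh₀` (α8's `Adm22 D R (L·Mh)` form); `1 ≤ K − n` and `K − n + 1 ≤ m + K` follow from `n < K`, `1 ≤ m`; the exported `B₀` is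
raised to `max B₀ 0 + 1 > 0` through the letter monotonicities ✓`hSupLetterG_mono`∕`gtSupLetterG_mono`∕`gtLaplaceLetterG_mono`∕`hDecayLetterD_mono`
((162) is `B₀`-free).

Cell `ym3-torus` (HUMAN RULING D-0037, YM ladder rung R3 — continuum SU(2) YM₃ on the torus is a RUNG, not the Clay problem, not `d = 4`, not a mass gap),
explicit-unit width seat `ym-ust-20520-w1` gen 6; `--supports stmt-QuantumFields-19200 --as helper` (cross-item tag as worded by the OWNER for 20520-keyed hands
on H rows); count-neutral; def-free, 0 sorry, standard axioms.  HONEST SCOPE: after this file the P2 binder of the H-door is a THEOREM; the door still displays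
(P1♭) `core` (WANTED №g26-5) and (C_E) `hCE`; the H stub, crux 19200, crux 20520, the rung and the gap are NOT touched.

References: T. Bałaban, CMP **102** (1985) 277–309 [Balaban1985Variational] (45)–(46) p.285, (143)–(144) p.300, (157)–(158) p.302, (161)–(163) p.303, (165) p.304;
CMP **96** (1984) 223–250 [Balaban1984PropagatorsII] (2.1)–(2.3) p.224, Prop. 2.6 (2.136) p.247, Cor. 2.8 (2.150)–(2.151) p.249.
-/

set_option autoImplicit false

noncomputable section

namespace Summit.QuantumFields.YangMills.Theorems.FlatOpsAdmAtMSAllL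

open Literature.MathematicalPhysics.QuantumFieldTheory.Balaban1983to89
open T3ContinuumYM3Torus (T3Family)
open FlatCubeOpsText (FlatOpsAdmAtMS)
open FlatOpsLettersAssembly (hSupLetterG_mono gtSupLetterG_mono gtLaplaceLetterG_mono hDecayLetterD_mono)
open FlatPortAllSizesAllL (body_of_adm22_allSizes_allL)

/-- ★★ **THE P2 TEXT OF RECORD IS INHABITED FOR EVERY ODD `L ≥ 3`**: there are thresholds `R₀, M₀` and constants `B₀, δ₀, B₃ > 0` (depending on `L` only) with
`FlatOpsAdmAtMS L R₀ M₀ B₀ δ₀ B₃` — [Balaban1985Variational]'s operators `H = GQ*(QGQ*)⁻¹`, `G̃ = G − HQG` of (45)∕(143) on every admissible nested cube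
family with the (157)∕(158)∕(165) letters and the (162) row sum, from [Balaban1984PropagatorsII] Prop. 2.6 ∕ Cor. 2.8 as ported by the (α) chain
(✓`FlatPortAllSizesAllL.body_of_adm22_allSizes_allL`).  Pure bookkeeping over that theorem (see the module docstring).
[cite: Balaban1985Variational, (45)-(46) p.285, (143)-(144) p.300, (157)-(158) p.302, (161)-(163) p.303, (165) p.304; Balaban1984PropagatorsII, (2.1)-(2.3) p.224, Prop. 2.6 (2.136) p.247, Cor. 2.8 (2.150)-(2.151) p.249] -/
theorem flatOpsAdmAtMS_allL (L : ℕ) (hL : Odd L ∧ 1 < L) :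
    ∃ (R₀ M₀ : ℕ) (B₀ δ₀ B₃ : ℝ), 0 < B₀ ∧ 0 < δ₀ ∧ 0 < B₃ ∧ FlatOpsAdmAtMS L R₀ M₀ B₀ δ₀ B₃ := by
  obtain ⟨ℓ, rfl⟩ : ∃ ℓ, L = ℓ + 1 := ⟨L - 1, by omega⟩
  obtain ⟨Mh₀, R₀, B₀, δ₀, B₃, hδ₀, hB₃, hmain⟩ := body_of_adm22_allSizes_allL ℓ hL
  have hle : B₀ ≤ max B₀ 0 + 1 := (le_max_left B₀ 0).trans (le_add_of_nonneg_right zero_le_one)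
  refine ⟨R₀, (ℓ + 1) * max Mh₀ 1, max B₀ 0 + 1, δ₀, B₃, by positivity, hδ₀, hB₃, ?_⟩
  intro F hF n K hnK R M hR hM hMa D hDk hAdm w hw
  obtain ⟨a, rfl⟩ := hMa
  obtain ⟨L', hL', m, hm⟩ := F
  change L' = ℓ + 1 at hF
  subst hF
  -- the size binder: `M = (ℓ+1)^a ≥ (ℓ+1)·max Mh₀ 1` forces `a = a′ + 1`
  have hone : (ℓ + 1) * 1 ≤ (ℓ + 1) * max Mh₀ 1 := Nat.mul_le_mul_left (ℓ + 1) (le_max_right Mh₀ 1)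
  have ha : a ≠ 0 := by
    rintro rfl
    rw [pow_zero] at hM
    omega
  obtain ⟨a', rfl⟩ := Nat.exists_eq_succ_of_ne_zero ha
  rw [pow_succ'] at hM hAdm
  have hMh : Mh₀ ≤ (ℓ + 1) ^ a' :=
    (le_max_left Mh₀ 1).trans (Nat.le_of_mul_le_mul_left hM (Nat.succ_pos ℓ))
  obtain ⟨H, Gt, hFH, hFG, h1, h2, h3, dBI, hdom, h4, h5⟩ :=
    hmain m hm n K (by omega) (by omega) (Mh := (ℓ + 1) ^ a') rfl hMh hR D hDk hAdm w hw
  exact ⟨H, Gt, hFH, hFG, hSupLetterG_mono h1 hle, gtSupLetterG_mono h2 hle, gtLaplaceLetterG_mono h3 hle, dBI, hdom, h4,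
    hDecayLetterD_mono h5 hle⟩

/-- ★ **THE `hP2` BINDER OF THE H-DOOR ✓`HalvingStepOfPillars.halvingStep_of_rows`, VERBATIM, AS A THEOREM**: for every odd `L > 1` the P2 text holds with
positive constants — so the door reads `halvingStep_of_rows hP2_holds hP1 hCE`.
[cite: Balaban1985Variational, (157)-(158) p.302, (161)-(163) p.303, (165) p.304; Balaban1984PropagatorsII, Prop. 2.6 (2.136) p.247, Cor. 2.8 (2.150)-(2.151) p.249] -/
theorem hP2_holds :
    ∀ L : ℕ, Odd L → 1 < L → ∃ (R₀ M₀ : ℕ) (B₀ δ₀ B₃ : ℝ), 0 < B₀ ∧ 0 < δ₀ ∧ 0 < B₃ ∧ FlatOpsAdmAtMS L R₀ M₀ B₀ δ₀ B₃ :=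
  fun L hodd h1 => flatOpsAdmAtMS_allL L ⟨hodd, h1⟩

/-- **THE WEAK-SIGN FORM** (`0 ≤ B₀`, the shape ✓`HalvingStepOfPillars.hP2_pos_of_nonneg` and the `halvingStep_of_rows₀`-type consumers take).
[cite: Balaban1985Variational, (157)-(158) p.302, (161)-(163) p.303, (165) p.304; Balaban1984PropagatorsII, Prop. 2.6 (2.136) p.247, Cor. 2.8 (2.150)-(2.151) p.249] -/
theorem hP2₀_holds :
    ∀ L : ℕ, Odd L → 1 < L → ∃ (R₀ M₀ : ℕ) (B₀ δ₀ B₃ : ℝ), 0 ≤ B₀ ∧ 0 < δ₀ ∧ 0 < B₃ ∧ FlatOpsAdmAtMS L R₀ M₀ B₀ δ₀ B₃ := by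
  intro L hodd h1
  obtain ⟨R₀, M₀, B₀, δ₀, B₃, hB₀, hδ₀, hB₃, h⟩ := flatOpsAdmAtMS_allL L ⟨hodd, h1⟩
  exact ⟨R₀, M₀, B₀, δ₀, B₃, hB₀.le, hδ₀, hB₃, h⟩

end Summit.QuantumFields.YangMills.Theorems.FlatOpsAdmAtMSAllL

end
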